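import Summits.HodgeConjecture.CorCM.MultiFieldWeilPrimeSlot
import Summits.HodgeConjecture.CorCM.Census.MultiFieldWeilPureSlot
import HarnessLib

/-!
# COR-CM — `E × T × B₇` over a SEXTIC and a TETRADECIC CM field sharing `k` THROUGH THE MULTI-FIELD WEIL ENGINE: the frame family and THE DEFECT LAW, hypothesis-free —
# the first end-to-end consumer of the census toolkit (pure realised `7`-cycle + cyclotomic separation for the tetradecic slot, transitivity on singletons for the
# sextic slot)

Cell `pub-hodgecm2` (COR-CM), seat b30 gen 29 (2026-08-24); count-neutral own lane (stem `SexticTetradecicWeil*`, CLAIM-ADDENDUM #2).  Theorems plus bookkeeping definitions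
(`n27`, `c27`, `w27`, `P27`, the frame family `e27`, the embeddings `im27`); no named fact, no `sorry`, no `decide`.

THE INSTANCE.  `r = 2` fields through the imaginary quadratic `k`: `K₁` SEXTIC (`n = 3` conjugate pairs over `τ`, type of `k`-signature `(1,2)` read at `{0}`, curve multiplicity `1`,
Weil part the FOURFOLD `T × E`) and `K₇` TETRADECIC (`n = 7`, ANY type with `q` members over `τ`, `0 < q`, `2q < 7`, read at the position set `Q ⊆ Fin 7` its frame defines —
`MultiFieldWeil.mem_iff_snd_eq_decide_mem_posSet`, no normal form —, curve multiplicity `7 − 2q`, Weil part `B₇ × E^{7−2q}` of dimension `14 − 2q`).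
THE DEFECT LAW (`exists_hasDefectsG_realisedTuples27`) with NO hypothesis on the fields: (i) the tetradecic slot has PRIME size `7 > 3`, so a PURE realised tuple rotating it
exists (`MultiFieldWeil.exists_pure_mem_realisedTuples`: Cauchy in the transitive slot image + a power killing the sextic component), its rotation is a conjugate of `(+1)`
(`exists_conj_finRotate_of_orderOf_eq`), and the translates of `Q` separate by the cyclotomic lemma (`Census.MultiFieldWeil.sep_of_conj_rotate`): `d₇ ≡ t₇`
(`const_of_signed_pure`); (ii) with the tetradecic slot constant, the sextic slot is peeled by transitivity on its three singletons (`const_of_signed_jointSetTransitive_on`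
with `S = {0}`, `sep_of_singletons`, `transitive_realisedTuples`): `d₁ ≡ t₁`; (iii) `exists_defects_of_const`: `e = t₁ + (7 − 2q) t₇`.
[cite: DixonMortimer1996, §1.6 and §2.1] [cite: MoonenZarhin1995Duke, Thm. 2.4] [cite: GaoUllmo2025, Thm 3.1] [cite: Shimura1998, §18.2 Lemma (i)]

## References
* [DixonMortimer1996] J. D. Dixon, B. Mortimer, *Permutation Groups*, GTM 163, §1.6, §2.1.  [MoonenZarhin1995Duke] B. Moonen, Yu. Zarhin, Duke Math. J. 77 (1995), Thm. 2.4.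
  [GaoUllmo2025] Z. Gao, E. Ullmo, J. Inst. Math. Jussieu 25 (2025), Thm 3.1.  [Shimura1998] G. Shimura, *Abelian varieties with CM and modular functions*, §18.2 Lemma (i).
-/

noncomputable section

open NumberField

namespace Summit.HodgeConjecture.CorCM.SexticTetradecicWeil

open Finset
open Literature.AlgebraicGeometry Literature.AlgebraicGeometry.Motives
open Summit.HodgeConjecture.CorCM.Census.MultiFieldWeil
open Summit.HodgeConjecture.CorCM.MultiFieldWeil

open scoped Classical

/-! ## §1 The data of the instance -/

/-- Numbers of conjugate pairs: `3, 7` (sextic, tetradecic). [folklore] -/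
def n27 : Fin 2 → ℕ := ![3, 7]

/-- Curve multiplicities for a tetradecic type with `q` members over `τ`: `1, 7 − 2q`. [folklore] -/
def c27 (q : ℕ) : Fin 2 → ℕ := ![1, 7 - 2 * q]

/-- Part sizes: `2, 7 − q` (the fourfold `T × E` and the `(14 − 2q)`-fold `B₇ × E^{7−2q}`). [folklore] -/
def w27 (q : ℕ) : Fin 2 → ℕ := ![2, 7 - q]

/-- The position sets: `{0}` for the sextic slot, the given `Q ⊆ Fin 7` for the tetradecic slot. [folklore] -/
def P27 (Q : Finset (Fin 7)) : ∀ m : Fin 2, Finset (Fin (n27 m)) := fun m =>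
  Fin.cases (motive := fun m => Finset (Fin (n27 m))) ({0} : Finset (Fin 3))
    (fun m => Fin.cases (motive := fun m : Fin 1 => Finset (Fin (n27 m.succ))) Q (fun m => m.elim0) m) m

/-- `P27 Q 0 = {0}`. [folklore] -/
@[simp] theorem P27_zero (Q : Finset (Fin 7)) : P27 Q 0 = ({0} : Finset (Fin 3)) := rfl
/-- `P27 Q 1 = Q`. [folklore] -/
@[simp] theorem P27_one (Q : Finset (Fin 7)) : P27 Q 1 = Q := rfl

/-- `n_m + c_m = 2 w_m` (`q ≤ 3`). [folklore] -/
theorem n27_add_c27 {q : ℕ} (hq : 2 * q < 7) (m : Fin 2) : n27 m + c27 q m = 2 * w27 q m := by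
  refine Fin.cases ?_ (fun m => Fin.cases ?_ (fun m => m.elim0) m) m
  · rfl
  · show 7 + (7 - 2 * q) = 2 * (7 - q); omega

/-- `c_m < n_m` (`0 < q`). [folklore] -/
theorem c27_lt_n27 {q : ℕ} (hq0 : 0 < q) (m : Fin 2) : c27 q m < n27 m := by
  refine Fin.cases ?_ (fun m => Fin.cases ?_ (fun m => m.elim0) m) m
  · show 1 < 3; omega
  · show 7 - 2 * q < 7; omega

/-- `c_m = n_m − 2|P m|` as integers, for `|Q| = q`, `2q < 7`. [folklore] -/
theorem c27_eq {Q : Finset (Fin 7)} {q : ℕ} (hQ : Q.card = q) (hq : 2 * q < 7) (m : Fin 2) : ((c27 q m : ℕ) : ℤ) = (n27 m : ℤ) - 2 * (P27 Q m).card := by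
  refine Fin.cases ?_ (fun m => Fin.cases ?_ (fun m => m.elim0) m) m
  · show ((1 : ℕ) : ℤ) = ((3 : ℕ) : ℤ) - 2 * (({0} : Finset (Fin 3)).card : ℤ)
    rw [Finset.card_singleton]; norm_num
  · show (((7 - 2 * q : ℕ)) : ℤ) = ((7 : ℕ) : ℤ) - 2 * (Q.card : ℤ)
    rw [hQ]; omega

/-! ## §2 The two frames as a frame family -/

section Frames

variable {I : Type} {Kf : I → Type} [∀ i, Field (Kf i)] {i₀ : I} {is : Fin 2 → I}

variable (is) in
/-- **The frame family** `(e₁; e₇)` of the generic model (`n27 = (3, 7)`). [folklore] -/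
def e27 (e₁ : (Kf (is 0) →+* ℂ) ≃ Fin 3 × Bool) (e₇ : (Kf (is 1) →+* ℂ) ≃ Fin 7 × Bool) :
    ∀ m : Fin 2, (Kf (is m) →+* ℂ) ≃ Fin (n27 m) × Bool := fun m =>
  Fin.cases (motive := fun m => (Kf (is m) →+* ℂ) ≃ Fin (n27 m) × Bool) e₁
    (fun m => Fin.cases (motive := fun m : Fin 1 => (Kf (is m.succ) →+* ℂ) ≃ Fin (n27 m.succ) × Bool) e₇ (fun m => m.elim0) m) m

variable (is) in
/-- **The embeddings of `k`** `(i₁; i₇)` as a family. [folklore] -/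
def im27 (i₁ : Kf i₀ →+* Kf (is 0)) (i₇ : Kf i₀ →+* Kf (is 1)) : ∀ m : Fin 2, Kf i₀ →+* Kf (is m) := fun m =>
  Fin.cases (motive := fun m => Kf i₀ →+* Kf (is m)) i₁
    (fun m => Fin.cases (motive := fun m : Fin 1 => Kf i₀ →+* Kf (is m.succ)) i₇ (fun m => m.elim0) m) m

variable (e₁ : (Kf (is 0) →+* ℂ) ≃ Fin 3 × Bool) (e₇ : (Kf (is 1) →+* ℂ) ≃ Fin 7 × Bool) (i₁ : Kf i₀ →+* Kf (is 0)) (i₇ : Kf i₀ →+* Kf (is 1))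

/-- `e27 0 = e₁`. [folklore] -/
@[simp] theorem e27_zero : e27 is e₁ e₇ 0 = e₁ := rfl
/-- `e27 1 = e₇`. [folklore] -/
@[simp] theorem e27_one : e27 is e₁ e₇ 1 = e₇ := rfl
/-- `im27 0 = i₁`. [folklore] -/
@[simp] theorem im27_zero : im27 is i₁ i₇ 0 = i₁ := rfl
/-- `im27 1 = i₇`. [folklore] -/
@[simp] theorem im27_one : im27 is i₁ i₇ 1 = i₇ := rfl

variable {e₁ e₇ i₁ i₇} {τ : Kf i₀ →+* ℂ}

/-- The sign readings of the family. [folklore] -/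
theorem he27_sign (he₁_sign : ∀ s, (e₁ s).2 = true ↔ s.comp i₁ = τ) (he₇_sign : ∀ s, (e₇ s).2 = true ↔ s.comp i₇ = τ) :
    ∀ (m : Fin 2) (s : Kf (is m) →+* ℂ), (e27 is e₁ e₇ m s).2 = true ↔ s.comp (im27 is i₁ i₇ m) = τ := fun m =>
  Fin.cases (motive := fun m => ∀ s : Kf (is m) →+* ℂ, (e27 is e₁ e₇ m s).2 = true ↔ s.comp (im27 is i₁ i₇ m) = τ) he₁_sign
    (fun m => Fin.cases (motive := fun m : Fin 1 => ∀ s : Kf (is m.succ) →+* ℂ,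
        (e27 is e₁ e₇ m.succ s).2 = true ↔ s.comp (im27 is i₁ i₇ m.succ) = τ) he₇_sign (fun m => m.elim0) m) m

/-- The conjugation readings of the family. [folklore] -/
theorem he27_conj (he₁_conj : ∀ s, e₁ (ComplexEmbedding.conjugate s) = ((e₁ s).1, !(e₁ s).2))
    (he₇_conj : ∀ s, e₇ (ComplexEmbedding.conjugate s) = ((e₇ s).1, !(e₇ s).2)) :
    ∀ (m : Fin 2) (s : Kf (is m) →+* ℂ), e27 is e₁ e₇ m (ComplexEmbedding.conjugate s) = ((e27 is e₁ e₇ m s).1, !(e27 is e₁ e₇ m s).2) := fun m =>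
  Fin.cases (motive := fun m => ∀ s : Kf (is m) →+* ℂ,
      e27 is e₁ e₇ m (ComplexEmbedding.conjugate s) = ((e27 is e₁ e₇ m s).1, !(e27 is e₁ e₇ m s).2)) he₁_conj
    (fun m => Fin.cases (motive := fun m : Fin 1 => ∀ s : Kf (is m.succ) →+* ℂ,
        e27 is e₁ e₇ m.succ (ComplexEmbedding.conjugate s) = ((e27 is e₁ e₇ m.succ s).1, !(e27 is e₁ e₇ m.succ s).2)) he₇_conj
      (fun m => m.elim0) m) m

variable {Φ : ∀ j : Fin (2 + 1), CMType (Kf (mfSlots i₀ is j))}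

/-- The type readings of the family at `P27 Q = ({0}, Q)`. [folklore] -/
theorem hΦ27 {Q : Finset (Fin 7)} (hΦ₁ : ∀ s : Kf (is 0) →+* ℂ, s ∈ (Φ 1).1 ↔ (e₁ s).2 = decide ((e₁ s).1 = 0))
    (hΦ₇ : ∀ s : Kf (is 1) →+* ℂ, s ∈ (Φ 2).1 ↔ (e₇ s).2 = decide ((e₇ s).1 ∈ Q)) :
    ∀ (m : Fin 2) (s : Kf (is m) →+* ℂ), s ∈ (Φ m.succ).1 ↔ (e27 is e₁ e₇ m s).2 = decide ((e27 is e₁ e₇ m s).1 ∈ P27 Q m) := by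
  have h0 : ∀ s : Kf (is 0) →+* ℂ, s ∈ (Φ 1).1 ↔ (e27 is e₁ e₇ 0 s).2 = decide ((e27 is e₁ e₇ 0 s).1 ∈ P27 Q 0) := fun s => by
    refine (hΦ₁ s).trans ?_
    show (e₁ s).2 = decide ((e₁ s).1 = 0) ↔ (e₁ s).2 = decide ((e₁ s).1 ∈ ({0} : Finset (Fin 3)))
    rw [decide_eq_decide.2 Finset.mem_singleton]
  have h1 : ∀ s : Kf (is 1) →+* ℂ, s ∈ (Φ 2).1 ↔ (e27 is e₁ e₇ 1 s).2 = decide ((e27 is e₁ e₇ 1 s).1 ∈ P27 Q 1) := fun s => hΦ₇ s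
  intro m
  exact Fin.cases (motive := fun m => ∀ s : Kf (is m) →+* ℂ, s ∈ (Φ m.succ).1 ↔ (e27 is e₁ e₇ m s).2 = decide ((e27 is e₁ e₇ m s).1 ∈ P27 Q m))
    h0 (fun m => Fin.cases (motive := fun m : Fin 1 => ∀ s : Kf (is m.succ) →+* ℂ,
      s ∈ (Φ m.succ.succ).1 ↔ (e27 is e₁ e₇ m.succ s).2 = decide ((e27 is e₁ e₇ m.succ s).1 ∈ P27 Q m.succ)) h1 (fun m => m.elim0) m) m

end Frames

/-! ## §3 The defect law, hypothesis-free, by the census toolkit -/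

section Defect

variable {I : Type} {Kf : I → Type} [∀ i, Field (Kf i)] [∀ i, NumberField (Kf i)] {i₀ : I} {is : Fin 2 → I}
  {e₁ : (Kf (is 0) →+* ℂ) ≃ Fin 3 × Bool} {e₇ : (Kf (is 1) →+* ℂ) ≃ Fin 7 × Bool}
  {i₁ : Kf i₀ →+* Kf (is 0)} {i₇ : Kf i₀ →+* Kf (is 1)} {τ : Kf i₀ →+* ℂ}
  (he₁_sign : ∀ s, (e₁ s).2 = true ↔ s.comp i₁ = τ) (he₇_sign : ∀ s, (e₇ s).2 = true ↔ s.comp i₇ = τ)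

include he₁_sign he₇_sign in
/-- **THE SLOT DEFECTS ARE CONSTANT** for every solution of the signed equations at the realised tuples of the two frames, `Q` a proper non-empty subset of the seven tetradecic
pairs: (i) tetradecic slot by a pure realised `7`-cycle and the cyclotomic separation, (ii) sextic slot by transitivity on singletons.  NO hypothesis on the fields.
[cite: DixonMortimer1996, §1.6 and §2.1] [cite: MoonenZarhin1995Duke, Thm. 2.4] -/
theorem const_of_signed27 {Q : Finset (Fin 7)} (hQ0 : Q.Nonempty) (hQ7 : Q.card < 7) {e : ℤ} {d : ∀ m : Fin 2, Fin (n27 m) → ℤ}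
    (h : ∀ π ∈ realisedTuples (e27 is e₁ e₇) τ, e + ∑ m : Fin 2, ∑ a : Fin (n27 m), (if π m a ∈ P27 Q m then d m a else -d m a) = 0) :
    ∀ (m : Fin 2) (a b : Fin (n27 m)), d m a = d m b := by
  have hsign := he27_sign (is := is) he₁_sign he₇_sign
  have hmul : ∀ π ∈ realisedTuples (e27 is e₁ e₇) τ, ∀ π' ∈ realisedTuples (e27 is e₁ e₇) τ, π * π' ∈ realisedTuples (e27 is e₁ e₇) τ :=
    fun π hπ π' hπ' => mul_mem_realisedTuples _ τ hπ hπ'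
  -- (i) the tetradecic slot: a pure realised `7`-cycle
  have h7 : (n27 1).Prime := by show (7 : ℕ).Prime; norm_num
  have hlt : ∀ m : Fin 2, m ≠ 1 → n27 m < n27 1 := by
    intro m hm
    fin_cases m
    · show 3 < 7; omega
    · exact absurd rfl hm
  obtain ⟨ρ, hρ, hpure, hord⟩ := exists_pure_mem_realisedTuples (e := e27 is e₁ e₇) hsign 1 h7 hlt
  have hconj : ∃ g : Equiv.Perm (Fin (n27 1)), g * finRotate (n27 1) * g⁻¹ = ρ 1 :=
    exists_conj_finRotate_of_orderOf_eq (k := 5) (by norm_num) (ρ 1) hord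
  obtain ⟨g, hg⟩ := hconj
  obtain ⟨π₀, hπ₀⟩ := realisedTuples_nonempty (e := e27 is e₁ e₇) hsign
  haveI : Fact (Nat.Prime (6 + 1)) := ⟨by norm_num⟩
  have hd7 : ∀ a b : Fin (n27 1), d 1 a = d 1 b := by
    refine const_of_signed_pure hmul hρ hpure hπ₀ (fun f hf => ?_) h
    exact sep_of_conj_rotate (k := 6) (π₀ 1) g hQ0 hQ7 f fun j => by
      have h1 := hf j
      rw [← hg] at h1
      exact h1
  -- (ii) the sextic slot: joint set-transitivity on the single slot `0` over the singletons
  have h3 : ∀ m ∈ ({0} : Finset (Fin 2)), ∀ a b : Fin (n27 m), d m a = d m b := by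
    refine const_of_signed_jointSetTransitive_on (R := realisedTuples (e27 is e₁ e₇) τ) (P := P27 Q)
      (𝒳 := fun m => univ.image fun a : Fin (n27 m) => ({a} : Finset (Fin (n27 m)))) {0} (fun m hm => ?_) (fun X hX => ?_) (fun m hm f hfX => ?_)
      (fun m hm => ?_) h
    · obtain rfl : m = 0 := Finset.mem_singleton.1 hm
      exact Finset.mem_image.2 ⟨⟨0, by show 0 < 3; omega⟩, Finset.mem_univ _, rfl⟩
    · obtain ⟨x, -, hx⟩ := Finset.mem_image.1 (hX 0 (Finset.mem_singleton_self 0))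
      obtain ⟨π, hπ, hπx⟩ := transitive_realisedTuples (e := e27 is e₁ e₇) hsign 0 x ⟨0, by show 0 < 3; omega⟩
      refine ⟨π, hπ, fun m hm a => ?_⟩
      obtain rfl : m = 0 := Finset.mem_singleton.1 hm
      rw [← hx, Finset.mem_singleton]
      show π 0 a ∈ ({⟨0, by show 0 < 3; omega⟩} : Finset (Fin (n27 0))) ↔ a = x
      rw [Finset.mem_singleton, ← hπx]
      exact ⟨fun hpa => (π 0).injective hpa, fun hax => by rw [hax]⟩
    · exact sep_of_singletons (fun a => Finset.mem_image.2 ⟨a, Finset.mem_univ _, rfl⟩) f hfX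
    · fin_cases m
      · exact absurd (Finset.mem_singleton_self _) hm
      · exact hd7
  -- both slots
  intro m
  fin_cases m
  · exact h3 0 (Finset.mem_singleton_self 0)
  · exact hd7

include he₁_sign he₇_sign in
/-- **THE DEFECT LAW for `E × T × B₇` over a sextic and a tetradecic CM field through `k`, NO hypothesis on the fields**: every configuration balanced under the realised tuples
obeys the defect law with curve multiplicities `c27 q = (1, 7 − 2q)` (`|Q| = q`, `0 < q`, `2q < 7`) — the hypothesis `hdef` of the generic headline.
[cite: MoonenZarhin1995Duke, Thm. 2.4] [cite: DixonMortimer1996, §2.1] -/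
theorem exists_hasDefectsG_realisedTuples27 {Q : Finset (Fin 7)} {q : ℕ} (hQ : Q.card = q) (hq0 : 0 < q) (hq : 2 * q < 7)
    {α : Type} (v : α → PtG n27) (T : Finset α) (hT : ModelBalancedG (P27 Q) (realisedTuples (e27 is e₁ e₇) τ) v T) :
    ∃ t : Fin 2 → ℤ, HasDefectsG (c27 q) v T t := by
  have hQ0 : Q.Nonempty := by rw [← Finset.card_pos, hQ]; exact hq0
  have hQ7 : Q.card < 7 := by omega
  have hconst := const_of_signed27 (is := is) he₁_sign he₇_sign hQ0 hQ7 fun π hπ => signed_of_modelBalancedG (realisedTuples (e27 is e₁ e₇) τ) v hT hπ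
  obtain ⟨t, hd, he⟩ := exists_defects_of_const (P := P27 Q) (realisedTuples_nonempty (e := e27 is e₁ e₇) (he27_sign (is := is) he₁_sign he₇_sign)) hconst
    fun π hπ => signed_of_modelBalancedG (realisedTuples (e27 is e₁ e₇) τ) v hT hπ
  refine ⟨t, fun m a => hd m a, ?_⟩
  rw [he]
  exact Finset.sum_congr rfl fun m _ => by rw [c27_eq hQ hq m]

end Defect

end Summit.HodgeConjecture.CorCM.SexticTetradecicWeil

end
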